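import Literature.AnabelianGeometry.SemiGraphs.MorphismRigidity

/-!
# Composition of morphisms of semi-graphs of anabelioids ([SemiAnbd] §2, Rmk 2.4.2) — construction

Mochizuki, *Semi-graphs of anabelioids*, Publ. RIMS **42** (2006), §2 Remark 2.4.2, author's
manuscript p.26 (kurims `paper:url-f33ace170ff4`). [cite: MochizukiSemiAnbd2006, Rmk 2.4.2, p. 26]

CONSTRUCTION ONLY (merge step M1 of the L3 bridge between the 2-categorical model of
`GraphOfAnabelioids.lean` / `MorphismRigidity.lean` and a 1-category of semi-graphs of anabelioids,
cell ruling abc-iut-L3-lead 2026-08-25T20:36Z); no printed statement is (re-)typed here.  A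
1-morphism `φ : 𝒢 → ℋ` (Def 2.1 / Rmk 2.4.2: morphism of underlying semi-graphs `f`, 1-morphisms of
constituent anabelioids `φ_v`, `φ_e`, and 2-isomorphisms `φ_b` between `𝒢_e → 𝒢_v → ℋ_w` and
`𝒢_e → ℋ_f → ℋ_w`) is t1's `SemiGraphOfAnabelioids.Hom` / `HomOver f`; this file supplies

* `HomOver.id`, `Hom.id` — identity 1-morphisms (identity exact functors; `φ_b` = unitors);
* `HomOver.comp`, `Hom.comp` — composition: compose underlying morphisms of semi-graphs, compose
  the constituent 1-morphisms of anabelioids (`Anabelioids.Hom.comp`, i.e. compose pull-back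
  functors), and PASTE the 2-cells `φ_b`, `ψ_{f b}` (`pasteIso`, `compCell`);
* the 2-cells between 1-morphisms over a fixed base (`HomOver.Iso2` of `MorphismRigidity.lean`) form
  a groupoid: `Iso2.refl`, `Iso2.symm`, `Iso2.trans`;
* congruence: `Iso2.hcomp` — 2-isomorphic factors have 2-isomorphic composites (so that composition
  descends to isomorphism classes of 1-morphisms, the arrows of the 1-category of Rmk 2.4.2 "we may
  work with such morphisms as if they are simply morphisms in a category").

Encoding note.  t1 indexes the edge components by `(e, e', h : f e = e')` to avoid transport; the
composite's edge component at `(e, e'')` is defined through the CANONICAL intermediate edge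
`f.edgeMap e` (`compE`), while the pasting at a branch `b` of `e` naturally passes through the
intermediate edge `ℋ.edgeOf (f b)` (equal, not definitionally); the two presentations are bridged
by `compEIso` (an identity after `subst`), and every lemma about the pasted cell is proved over an
ARBITRARY presentation of the intermediate edge and then specialised (`compCell`).  Unit and
associativity 2-cells are in the companion file `HomCompositionLaws.lean`.
-/

namespace Literature.AnabelianGeometry.SemiGraphs

open CategoryTheory Literature.AnabelianGeometry.Anabelioids

universe v₁ u₁ u

/-! ### Pasting of squares of functors (pure category theory) -/

section Paste

variable {Gv Ge Hv He Kv Ke : Type*} [Category Gv] [Category Ge] [Category Hv] [Category He]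
  [Category Kv] [Category Ke]

/-- Pasting two invertible 2-cells `α : φv ⋙ pG ≅ pH ⋙ φe` and `β : ψv ⋙ pH ≅ pK ⋙ ψe` along the common
functor `pH`: the 2-cell `(ψv ⋙ φv) ⋙ pG ≅ pK ⋙ (ψe ⋙ φe)` (the `φ_b` of a composite of 1-morphisms of
semi-graphs of anabelioids, Rmk 2.4.2). [cite: MochizukiSemiAnbd2006, Rmk 2.4.2, p. 26] -/
def pasteIso {φv : Hv ⥤ Gv} {pG : Gv ⥤ Ge} {pH : Hv ⥤ He} {φe : He ⥤ Ge} {ψv : Kv ⥤ Hv}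
    {pK : Kv ⥤ Ke} {ψe : Ke ⥤ He} (α : φv ⋙ pG ≅ pH ⋙ φe) (β : ψv ⋙ pH ≅ pK ⋙ ψe) :
    (ψv ⋙ φv) ⋙ pG ≅ pK ⋙ (ψe ⋙ φe) :=
  Functor.associator ψv φv pG ≪≫ Functor.isoWhiskerLeft ψv α ≪≫ (Functor.associator ψv pH φe).symm ≪≫
    Functor.isoWhiskerRight β φe ≪≫ Functor.associator pK ψe φe

/-- Components of the pasted 2-cell. [cite: MochizukiSemiAnbd2006, Rmk 2.4.2, p. 26] -/
@[simp] theorem pasteIso_hom_app {φv : Hv ⥤ Gv} {pG : Gv ⥤ Ge} {pH : Hv ⥤ He} {φe : He ⥤ Ge}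
    {ψv : Kv ⥤ Hv} {pK : Kv ⥤ Ke} {ψe : Ke ⥤ He} (α : φv ⋙ pG ≅ pH ⋙ φe) (β : ψv ⋙ pH ≅ pK ⋙ ψe)
    (X : Kv) : (pasteIso α β).hom.app X = α.hom.app (ψv.obj X) ≫ φe.map (β.hom.app X) := by
  simp [pasteIso]
  erw [Category.id_comp, Category.id_comp, Category.comp_id]
  rfl

/-- Components of the inverse of the pasted 2-cell. [cite: MochizukiSemiAnbd2006, Rmk 2.4.2, p. 26] -/
@[simp] theorem pasteIso_inv_app {φv : Hv ⥤ Gv} {pG : Gv ⥤ Ge} {pH : Hv ⥤ He} {φe : He ⥤ Ge}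
    {ψv : Kv ⥤ Hv} {pK : Kv ⥤ Ke} {ψe : Ke ⥤ He} (α : φv ⋙ pG ≅ pH ⋙ φe) (β : ψv ⋙ pH ≅ pK ⋙ ψe)
    (X : Kv) : (pasteIso α β).inv.app X = φe.map (β.inv.app X) ≫ α.inv.app (ψv.obj X) := by
  simp [pasteIso]
  erw [Category.id_comp, Category.id_comp, Category.comp_id]
  rfl

end Paste

namespace SemiGraphOfAnabelioids

variable {𝒢 ℋ 𝒦 : SemiGraphOfAnabelioids.{v₁, u₁, u}}

/-! ### Identity 1-morphisms -/

variable (𝒢) in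
/-- The identity 1-morphism of the constituent anabelioid `𝒢_e`, read as a morphism `𝒢_e → 𝒢_{e'}`
along an equality `e = e'` of edges (t1's edge components are indexed by such equalities).
[cite: MochizukiSemiAnbd2006, Rmk 2.4.2, p. 26] -/
noncomputable def idE (e e' : 𝒢.graph.Edge) (h : e = e') : Anabelioids.Hom (𝒢.E e) (𝒢.E e') := by
  subst h; exact Anabelioids.Hom.id (𝒢.E e)

/-- At `e' = e` the transported identity is the identity. [cite: MochizukiSemiAnbd2006, Rmk 2.4.2, p. 26] -/
@[simp] theorem idE_rfl (e : 𝒢.graph.Edge) : 𝒢.idE e e rfl = Anabelioids.Hom.id (𝒢.E e) := rfl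

variable (𝒢) in
/-- The identity 1-morphism of `𝒢` over the identity of its underlying semi-graph: identity
functors on the constituent anabelioids, unitors as the 2-cells `φ_b`.
[cite: MochizukiSemiAnbd2006, Rmk 2.4.2, p. 26] -/
noncomputable def HomOver.id : HomOver 𝒢 𝒢 (𝟙 𝒢.graph) where
  φV v := Anabelioids.Hom.id (𝒢.V v)
  φE e e' h := 𝒢.idE e e' h
  φB b v h := (𝒢.pull b v h).pullback.leftUnitor ≪≫ (𝒢.pull b v h).pullback.rightUnitor.symm

variable (𝒢) in
/-- The identity 1-morphism of a semi-graph of anabelioids. [cite: MochizukiSemiAnbd2006, Rmk 2.4.2, p. 26] -/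
noncomputable def Hom.id : Hom 𝒢 𝒢 := (HomOver.id 𝒢).toHom

/-! ### Composition of 1-morphisms -/

section Comp

variable {f : 𝒢.graph ⟶ ℋ.graph} {g : ℋ.graph ⟶ 𝒦.graph}

/-- Edge components of a composite, through the canonical intermediate edge `f e`:
`(ψ ∘ φ)_e := ψ_{f e} ∘ φ_e`. [cite: MochizukiSemiAnbd2006, Rmk 2.4.2, p. 26] -/
noncomputable def HomOver.compE (φ : HomOver 𝒢 ℋ f) (ψ : HomOver ℋ 𝒦 g) (e : 𝒢.graph.Edge)
    (e'' : 𝒦.graph.Edge) (h : g.edgeMap (f.edgeMap e) = e'') :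
    Anabelioids.Hom (𝒢.E e) (𝒦.E e'') :=
  (φ.φE e (f.edgeMap e) rfl).comp (ψ.φE (f.edgeMap e) e'' h)

/-- The edge component of a composite computed through ANY presentation `e₁` of the intermediate
edge agrees with the canonical one (by `subst`). [cite: MochizukiSemiAnbd2006, Rmk 2.4.2, p. 26] -/
theorem HomOver.compE_eq (φ : HomOver 𝒢 ℋ f) (ψ : HomOver ℋ 𝒦 g) (e : 𝒢.graph.Edge)
    (e₁ : ℋ.graph.Edge) (h₁ : f.edgeMap e = e₁) (e'' : 𝒦.graph.Edge) (h₂ : g.edgeMap e₁ = e'') :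
    φ.compE ψ e e'' (by rw [h₁, h₂]) = (φ.φE e e₁ h₁).comp (ψ.φE e₁ e'' h₂) := by
  subst h₁; rfl

/-- The bridge between the two presentations of a composite edge component, as an (identity)
isomorphism of pull-back functors. [cite: MochizukiSemiAnbd2006, Rmk 2.4.2, p. 26] -/
noncomputable def HomOver.compEIso (φ : HomOver 𝒢 ℋ f) (ψ : HomOver ℋ 𝒦 g) (e : 𝒢.graph.Edge)
    (e₁ : ℋ.graph.Edge) (h₁ : f.edgeMap e = e₁) (e'' : 𝒦.graph.Edge) (h₂ : g.edgeMap e₁ = e'') :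
    ((φ.φE e e₁ h₁).comp (ψ.φE e₁ e'' h₂)).pullback ≅ (φ.compE ψ e e'' (by rw [h₁, h₂])).pullback := by
  subst h₁; exact Iso.refl _

/-- At the canonical presentation the bridge is the identity. [cite: MochizukiSemiAnbd2006, Rmk 2.4.2, p. 26] -/
@[simp] theorem HomOver.compEIso_rfl (φ : HomOver 𝒢 ℋ f) (ψ : HomOver ℋ 𝒦 g) (e : 𝒢.graph.Edge)
    (e'' : 𝒦.graph.Edge) (h₂ : g.edgeMap (f.edgeMap e) = e'') :
    φ.compEIso ψ e (f.edgeMap e) rfl e'' h₂ = Iso.refl _ := rfl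

/-- The pasted 2-cell of a composite at a branch, over an ARBITRARY presentation of the intermediate
and final edges and arbitrary "pull" 1-morphisms `pG`, `pH`, `pK` (all uses: `pG = b_*`,
`pH = (f b)_*`, `pK = (g f b)_*`, `e₁ = ℋ.edgeOf (f b)`, `e₂ = 𝒦.edgeOf (g f b)`):
paste `α` (for `φ_b`) and `β` (for `ψ_{f b}`) and bridge to the canonical edge component.
[cite: MochizukiSemiAnbd2006, Rmk 2.4.2, p. 26] -/
noncomputable def HomOver.compCell (φ : HomOver 𝒢 ℋ f) (ψ : HomOver ℋ 𝒦 g) {e : 𝒢.graph.Edge}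
    {v : 𝒢.graph.Vertex} (pG : Anabelioids.Hom (𝒢.E e) (𝒢.V v)) (e₁ : ℋ.graph.Edge)
    (h₁ : f.edgeMap e = e₁) (pH : Anabelioids.Hom (ℋ.E e₁) (ℋ.V (f.vertexMap v)))
    (e₂ : 𝒦.graph.Edge) (h₂ : g.edgeMap e₁ = e₂)
    (pK : Anabelioids.Hom (𝒦.E e₂) (𝒦.V (g.vertexMap (f.vertexMap v))))
    (α : (φ.φV v).pullback ⋙ pG.pullback ≅ pH.pullback ⋙ (φ.φE e e₁ h₁).pullback)
    (β : (ψ.φV (f.vertexMap v)).pullback ⋙ pH.pullback ≅ pK.pullback ⋙ (ψ.φE e₁ e₂ h₂).pullback) :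
    ((φ.φV v).comp (ψ.φV (f.vertexMap v))).pullback ⋙ pG.pullback ≅
      pK.pullback ⋙ (φ.compE ψ e e₂ (by rw [h₁, h₂])).pullback :=
  pasteIso α β ≪≫ Functor.isoWhiskerLeft pK.pullback (φ.compEIso ψ e e₁ h₁ e₂ h₂)

/-- Components of the bridge: an `eqToHom` (an identity whenever the two presentations of the
intermediate edge agree definitionally). [cite: MochizukiSemiAnbd2006, Rmk 2.4.2, p. 26] -/
theorem HomOver.compEIso_hom_app (φ : HomOver 𝒢 ℋ f) (ψ : HomOver ℋ 𝒦 g) (e : 𝒢.graph.Edge)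
    (e₁ : ℋ.graph.Edge) (h₁ : f.edgeMap e = e₁) (e'' : 𝒦.graph.Edge) (h₂ : g.edgeMap e₁ = e'')
    (X : 𝒦.E e'') :
    (φ.compEIso ψ e e₁ h₁ e'' h₂).hom.app X = eqToHom (by subst h₁; rfl) := by
  subst h₁; rfl

/-- Components of the pasted 2-cell of a composite: `φ_b` at `ψ_v^* X`, then `φ_e^*` of `ψ_{f b}` at
`X`, then the bridge. [cite: MochizukiSemiAnbd2006, Rmk 2.4.2, p. 26] -/
theorem HomOver.compCell_hom_app (φ : HomOver 𝒢 ℋ f) (ψ : HomOver ℋ 𝒦 g) {e : 𝒢.graph.Edge}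
    {v : 𝒢.graph.Vertex} (pG : Anabelioids.Hom (𝒢.E e) (𝒢.V v)) (e₁ : ℋ.graph.Edge)
    (h₁ : f.edgeMap e = e₁) (pH : Anabelioids.Hom (ℋ.E e₁) (ℋ.V (f.vertexMap v)))
    (e₂ : 𝒦.graph.Edge) (h₂ : g.edgeMap e₁ = e₂)
    (pK : Anabelioids.Hom (𝒦.E e₂) (𝒦.V (g.vertexMap (f.vertexMap v))))
    (α : (φ.φV v).pullback ⋙ pG.pullback ≅ pH.pullback ⋙ (φ.φE e e₁ h₁).pullback)
    (β : (ψ.φV (f.vertexMap v)).pullback ⋙ pH.pullback ≅ pK.pullback ⋙ (ψ.φE e₁ e₂ h₂).pullback)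
    (X : 𝒦.V (g.vertexMap (f.vertexMap v))) :
    (φ.compCell ψ pG e₁ h₁ pH e₂ h₂ pK α β).hom.app X =
      α.hom.app ((ψ.φV (f.vertexMap v)).pullback.obj X) ≫
        (φ.φE e e₁ h₁).pullback.map (β.hom.app X) ≫
          (φ.compEIso ψ e e₁ h₁ e₂ h₂).hom.app (pK.pullback.obj X) := by
  simp only [HomOver.compCell, Iso.trans_hom, NatTrans.comp_app, Functor.isoWhiskerLeft_hom,
    Functor.whiskerLeft_app, pasteIso_hom_app]
  repeat erw [Category.assoc]
  rfl

/-- **Composition of 1-morphisms of semi-graphs of anabelioids** over composable morphisms of the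
underlying semi-graphs: `(ψ ∘ φ)_v := ψ_{f v} ∘ φ_v`, `(ψ ∘ φ)_e := ψ_{f e} ∘ φ_e`, and
`(ψ ∘ φ)_b` the pasting of `φ_b` and `ψ_{f b}`. [cite: MochizukiSemiAnbd2006, Rmk 2.4.2, p. 26] -/
noncomputable def HomOver.comp (φ : HomOver 𝒢 ℋ f) (ψ : HomOver ℋ 𝒦 g) : HomOver 𝒢 𝒦 (f ≫ g) where
  φV v := (φ.φV v).comp (ψ.φV (f.vertexMap v))
  φE e e'' h := φ.compE ψ e e'' h
  φB b v hb :=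
    φ.compCell ψ (𝒢.pull b v hb) (ℋ.graph.edgeOf (f.branchMap b)) (f.edgeOf_branchMap b).symm
      (ℋ.pull (f.branchMap b) (f.vertexMap v) (f.abuts_branchMap b v hb))
      (𝒦.graph.edgeOf (g.branchMap (f.branchMap b))) (g.edgeOf_branchMap (f.branchMap b)).symm
      (𝒦.pull (g.branchMap (f.branchMap b)) (g.vertexMap (f.vertexMap v))
        (g.abuts_branchMap _ _ (f.abuts_branchMap b v hb)))
      (φ.φB b v hb) (ψ.φB (f.branchMap b) (f.vertexMap v) (f.abuts_branchMap b v hb))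

end Comp

/-! ### 2-cells: the groupoid structure on `Iso2` -/

namespace HomOver.Iso2

variable {f : 𝒢.graph ⟶ ℋ.graph} {φ φ' φ'' : HomOver 𝒢 ℋ f}

/-- Component form of the coherence condition of a 2-cell along an abutting branch.
[cite: MochizukiSemiAnbd2006, Rmk 2.4.2, p. 26] -/
theorem coh_app (σ : Iso2 φ φ') (b : 𝒢.graph.Branch) (v : 𝒢.graph.Vertex)
    (h : 𝒢.graph.abuts b = some v) (X : ℋ.V (f.vertexMap v)) :
    (φ.φB b v h).hom.app X ≫ (σ.isoE (𝒢.graph.edgeOf b) (ℋ.graph.edgeOf (f.branchMap b))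
        (f.edgeOf_branchMap b).symm).hom.app
        ((ℋ.pull (f.branchMap b) (f.vertexMap v) (f.abuts_branchMap b v h)).pullback.obj X) =
      (𝒢.pull b v h).pullback.map ((σ.isoV v).hom.app X) ≫ (φ'.φB b v h).hom.app X := by
  have := NatTrans.congr_app (congrArg Iso.hom (σ.coh b v h)) X
  simp only [Iso.trans_hom, NatTrans.comp_app, Functor.isoWhiskerLeft_hom, Functor.whiskerLeft_app,
    Functor.isoWhiskerRight_hom, Functor.whiskerRight_app] at this
  exact this

/-- The identity 2-cell. [cite: MochizukiSemiAnbd2006, Rmk 2.4.2, p. 26] -/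
def refl (φ : HomOver 𝒢 ℋ f) : Iso2 φ φ where
  isoV v := Iso.refl _
  isoE e e' h := Iso.refl _
  coh b v h := by ext X; simp

/-- The inverse of a 2-cell. [cite: MochizukiSemiAnbd2006, Rmk 2.4.2, p. 26] -/
def symm (σ : Iso2 φ φ') : Iso2 φ' φ where
  isoV v := (σ.isoV v).symm
  isoE e e' h := (σ.isoE e e' h).symm
  coh b v h := by
    ext X
    have hc := σ.coh_app b v h X
    simp only [Iso.trans_hom, NatTrans.comp_app, Functor.isoWhiskerLeft_hom, Functor.whiskerLeft_app,
      Functor.isoWhiskerRight_hom, Functor.whiskerRight_app, Iso.symm_hom]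
    erw [← Iso.app_inv, Iso.comp_inv_eq, Iso.app_hom, Category.assoc, hc, ← Category.assoc,
      ← Functor.map_comp, Iso.inv_hom_id_app, CategoryTheory.Functor.map_id, Category.id_comp]

/-- Vertical composition of 2-cells. [cite: MochizukiSemiAnbd2006, Rmk 2.4.2, p. 26] -/
def trans (σ : Iso2 φ φ') (τ : Iso2 φ' φ'') : Iso2 φ φ'' where
  isoV v := σ.isoV v ≪≫ τ.isoV v
  isoE e e' h := σ.isoE e e' h ≪≫ τ.isoE e e' h
  coh b v h := by
    ext X
    have h₁ := σ.coh_app b v h X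
    have h₂ := τ.coh_app b v h X
    simp only [Iso.trans_hom, NatTrans.comp_app, Functor.isoWhiskerLeft_hom, Functor.whiskerLeft_app,
      Functor.isoWhiskerRight_hom, Functor.whiskerRight_app, Functor.map_comp]
    erw [← Category.assoc, h₁, Category.assoc, h₂, ← Category.assoc]
    rfl

end HomOver.Iso2

/-! ### Congruence: 2-isomorphic factors have 2-isomorphic composites -/

section HComp

variable {f : 𝒢.graph ⟶ ℋ.graph} {g : ℋ.graph ⟶ 𝒦.graph}
variable {φ φ' : HomOver 𝒢 ℋ f} {ψ ψ' : HomOver ℋ 𝒦 g}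

/-- Horizontal composite of 2-cells on vertex components. [cite: MochizukiSemiAnbd2006, Rmk 2.4.2, p. 26] -/
noncomputable def HomOver.Iso2.hcompV (σ : HomOver.Iso2 φ φ') (τ : HomOver.Iso2 ψ ψ')
    (v : 𝒢.graph.Vertex) :
    ((φ.comp ψ).φV v).pullback ≅ ((φ'.comp ψ').φV v).pullback :=
  Functor.isoWhiskerLeft (ψ.φV (f.vertexMap v)).pullback (σ.isoV v) ≪≫
    Functor.isoWhiskerRight (τ.isoV (f.vertexMap v)) (φ'.φV v).pullback

/-- Horizontal composite of 2-cells on edge components (through the canonical intermediate edge).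
[cite: MochizukiSemiAnbd2006, Rmk 2.4.2, p. 26] -/
noncomputable def HomOver.Iso2.hcompE (σ : HomOver.Iso2 φ φ') (τ : HomOver.Iso2 ψ ψ')
    (e : 𝒢.graph.Edge) (e'' : 𝒦.graph.Edge) (h : (f ≫ g).edgeMap e = e'') :
    ((φ.comp ψ).φE e e'' h).pullback ≅ ((φ'.comp ψ').φE e e'' h).pullback :=
  Functor.isoWhiskerLeft (ψ.φE (f.edgeMap e) e'' h).pullback (σ.isoE e (f.edgeMap e) rfl) ≪≫
    Functor.isoWhiskerRight (τ.isoE (f.edgeMap e) e'' h) (φ'.φE e (f.edgeMap e) rfl).pullback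

/-- Coherence of the horizontal composite, over an arbitrary presentation of the intermediate edge
(proved after `subst`, where the bridge `compEIso` is the identity).
[cite: MochizukiSemiAnbd2006, Rmk 2.4.2, p. 26] -/
theorem HomOver.Iso2.hcomp_coh_aux (σ : HomOver.Iso2 φ φ') (τ : HomOver.Iso2 ψ ψ')
    {e : 𝒢.graph.Edge} {v : 𝒢.graph.Vertex} (pG : Anabelioids.Hom (𝒢.E e) (𝒢.V v))
    (e₁ : ℋ.graph.Edge) (h₁ : f.edgeMap e = e₁)
    (pH : Anabelioids.Hom (ℋ.E e₁) (ℋ.V (f.vertexMap v)))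
    (e₂ : 𝒦.graph.Edge) (h₂ : g.edgeMap e₁ = e₂)
    (pK : Anabelioids.Hom (𝒦.E e₂) (𝒦.V (g.vertexMap (f.vertexMap v))))
    (α : (φ.φV v).pullback ⋙ pG.pullback ≅ pH.pullback ⋙ (φ.φE e e₁ h₁).pullback)
    (α' : (φ'.φV v).pullback ⋙ pG.pullback ≅ pH.pullback ⋙ (φ'.φE e e₁ h₁).pullback)
    (β : (ψ.φV (f.vertexMap v)).pullback ⋙ pH.pullback ≅ pK.pullback ⋙ (ψ.φE e₁ e₂ h₂).pullback)
    (β' : (ψ'.φV (f.vertexMap v)).pullback ⋙ pH.pullback ≅ pK.pullback ⋙ (ψ'.φE e₁ e₂ h₂).pullback)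
    (hφ : α ≪≫ Functor.isoWhiskerLeft pH.pullback (σ.isoE e e₁ h₁) =
      Functor.isoWhiskerRight (σ.isoV v) pG.pullback ≪≫ α')
    (hψ : β ≪≫ Functor.isoWhiskerLeft pK.pullback (τ.isoE e₁ e₂ h₂) =
      Functor.isoWhiskerRight (τ.isoV (f.vertexMap v)) pH.pullback ≪≫ β') :
    φ.compCell ψ pG e₁ h₁ pH e₂ h₂ pK α β ≪≫
        Functor.isoWhiskerLeft pK.pullback (σ.hcompE τ e e₂ (by rw [← h₂, ← h₁]; rfl)) =
      Functor.isoWhiskerRight (σ.hcompV τ v) pG.pullback ≪≫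
        φ'.compCell ψ' pG e₁ h₁ pH e₂ h₂ pK α' β' := by
  subst h₁; subst h₂
  ext X
  have hφ' : ∀ Y, α.hom.app Y ≫ (σ.isoE e _ rfl).hom.app (pH.pullback.obj Y) =
      pG.pullback.map ((σ.isoV v).hom.app Y) ≫ α'.hom.app Y := fun Y => by
    have := NatTrans.congr_app (congrArg Iso.hom hφ) Y
    simp only [Iso.trans_hom, NatTrans.comp_app, Functor.isoWhiskerLeft_hom,
      Functor.whiskerLeft_app, Functor.isoWhiskerRight_hom, Functor.whiskerRight_app] at this
    exact this
  have hψ' : β.hom.app X ≫ (τ.isoE _ _ rfl).hom.app (pK.pullback.obj X) =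
      pH.pullback.map ((τ.isoV _).hom.app X) ≫ β'.hom.app X := by
    have := NatTrans.congr_app (congrArg Iso.hom hψ) X
    simp only [Iso.trans_hom, NatTrans.comp_app, Functor.isoWhiskerLeft_hom,
      Functor.whiskerLeft_app, Functor.isoWhiskerRight_hom, Functor.whiskerRight_app] at this
    exact this
  simp only [HomOver.compCell, HomOver.Iso2.hcompE, HomOver.Iso2.hcompV, Iso.trans_hom,
    NatTrans.comp_app, Functor.isoWhiskerLeft_hom, Functor.whiskerLeft_app,
    Functor.isoWhiskerRight_hom, Functor.whiskerRight_app, pasteIso_hom_app,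
    HomOver.compEIso_rfl, Iso.refl_hom, NatTrans.id_app, Functor.map_comp]
  erw [Category.comp_id, Category.comp_id]
  repeat erw [Category.assoc]
  erw [(σ.isoE e _ rfl).hom.naturality_assoc (β.hom.app X),
    reassoc_of% (hφ' ((ψ.φV (f.vertexMap v)).pullback.obj X)), ← Functor.map_comp, hψ',
    Functor.map_comp, α'.hom.naturality_assoc ((τ.isoV (f.vertexMap v)).hom.app X), Category.assoc]
  rfl

/-- **Congruence.** 2-isomorphic 1-morphisms have 2-isomorphic composites: the horizontal
composite of 2-cells (vertex and edge components whiskered; coherence by pasting).  Hence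
composition descends to isomorphism classes of 1-morphisms — the arrows of the 1-category of
[SemiAnbd] Rmk 2.4.2. [cite: MochizukiSemiAnbd2006, Rmk 2.4.2, p. 26] -/
noncomputable def HomOver.Iso2.hcomp (σ : HomOver.Iso2 φ φ') (τ : HomOver.Iso2 ψ ψ') :
    HomOver.Iso2 (φ.comp ψ) (φ'.comp ψ') where
  isoV v := σ.hcompV τ v
  isoE e e'' h := σ.hcompE τ e e'' h
  coh b v hb :=
    σ.hcomp_coh_aux τ (𝒢.pull b v hb) (ℋ.graph.edgeOf (f.branchMap b)) (f.edgeOf_branchMap b).symm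
      (ℋ.pull (f.branchMap b) (f.vertexMap v) (f.abuts_branchMap b v hb))
      (𝒦.graph.edgeOf (g.branchMap (f.branchMap b))) (g.edgeOf_branchMap (f.branchMap b)).symm
      (𝒦.pull (g.branchMap (f.branchMap b)) (g.vertexMap (f.vertexMap v))
        (g.abuts_branchMap _ _ (f.abuts_branchMap b v hb)))
      (φ.φB b v hb) (φ'.φB b v hb)
      (ψ.φB (f.branchMap b) (f.vertexMap v) (f.abuts_branchMap b v hb))
      (ψ'.φB (f.branchMap b) (f.vertexMap v) (f.abuts_branchMap b v hb))
      (σ.coh b v hb) (τ.coh (f.branchMap b) (f.vertexMap v) (f.abuts_branchMap b v hb))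

end HComp

/-- **Composition of 1-morphisms of semi-graphs of anabelioids.** [cite: MochizukiSemiAnbd2006, Rmk 2.4.2, p. 26] -/
noncomputable def Hom.comp (φ : Hom 𝒢 ℋ) (ψ : Hom ℋ 𝒦) : Hom 𝒢 𝒦 := (φ.over.comp ψ.over).toHom

/-- The underlying morphism of semi-graphs of a composite. [cite: MochizukiSemiAnbd2006, Rmk 2.4.2, p. 26] -/
@[simp] theorem Hom.comp_base (φ : Hom 𝒢 ℋ) (ψ : Hom ℋ 𝒦) : (φ.comp ψ).base = φ.base ≫ ψ.base := rfl

/-- The underlying morphism of semi-graphs of the identity. [cite: MochizukiSemiAnbd2006, Rmk 2.4.2, p. 26] -/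
@[simp] theorem Hom.id_base : (Hom.id 𝒢).base = 𝟙 𝒢.graph := rfl

end SemiGraphOfAnabelioids

end Literature.AnabelianGeometry.SemiGraphs
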